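import Literature.ModelTheory.ExponentialFields.SemialgebraicCertifiedWindowCuts
import Literature.ModelTheory.ExponentialFields.SemialgebraicCollarLenses
import HarnessLib

/-!
# The strong rich cut lemma: an indexed laminar refinement subordinate to an open cover

Topic `Literature/ModelTheory/ExponentialFields` — block B2d₃ of the proof of the
`C¹`-triangulation theorem for compact semialgebraic sets
(`Literature.ModelTheory.ExponentialFields.OhmotoShiota2017_c1Triangulation`, statement of
[OhmotoShiota2017, Thm. 1.1]) along the proof of [Pawlucki2024], specialized to `p = 1`.

**[Pawlucki2024, Prop. 2.5] in the strong laminar form used by Lemma 5.1**: for a capsule `[a, b]`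
over a compact semialgebraic `D` whose open fibres are covered by finitely many open semialgebraic
`V j`, there is a continuous semialgebraic laminar family `a = β₀ ≤ ⋯ ≤ β_r = b` on `D` and, for
every INDEX `n`, a member `V (jw n)` containing all nonempty open fibres `{x} × (β_n x, β_{n+1} x)`
(`exists_indexed_laminar_refinement`).  Proof: lens families (Part I, block B2b′), certified cuts
on every free window (block B2d₂, with the window functions added to the cut family so that all
certificate endpoints are cuts), the certified assembly (block B2d₁), and the extraction of
index-level witnesses (block B2d₀).

No named facts are introduced (D-0026).

## References

* [Pawlucki2024] W. Pawłucki, *Strict `C^p`-triangulations — a new approach to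
  desingularization*, J. Eur. Math. Soc. 26 (2024), 3863–3909, Prop. 2.5, Remark 2.3, Lemma 5.1.
* [OhmotoShiota2017] T. Ohmoto, M. Shiota, *`C¹`-triangulations of semialgebraic sets*,
  J. Topology 10 (2017), Thm. 1.1 (statement only).
-/

noncomputable section

open Set Filter
open _root_.Topology

namespace Literature.ModelTheory.ExponentialFields

open Literature.NumberTheory.Transcendental (IsSemialgebraicFunOn IsSemialgebraicMapOn)

section StrongRCL

variable {m q : ℕ}

/-- The lens functions are continuous. [cite: Pawlucki2024, Prop. 2.5] -/
theorem LensFamilies.continuous_cuts {F : LensFamilies m q} (H : F.Hyp) (j : Fin F.N) : Continuous (F.cuts j) := by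
  refine Fin.addCases (fun i => ?_) (fun i => ?_) j
  · refine Fin.addCases (fun i => ?_) (fun i => ?_) i
    · simp only [LensFamilies.cuts, Fin.append_left]; exact H.bm_cont i
    · simp only [LensFamilies.cuts, Fin.append_left, Fin.append_right]; exact H.bp_cont i
  · refine Fin.addCases (fun i => ?_) (fun i => ?_) i
    · simp only [LensFamilies.cuts, Fin.append_right, Fin.append_left]; exact H.tm_cont i
    · simp only [LensFamilies.cuts, Fin.append_right]; exact H.tp_cont i

open Classical in
/-- **The strong rich cut lemma** [Pawlucki2024, Prop. 2.5 with Remark 2.3, as used in Lemma 5.1]: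
an indexed laminar refinement subordinate to a finite open semialgebraic cover of the open fibres of
a capsule over a compact semialgebraic base. [cite: Pawlucki2024, Prop. 2.5, Remark 2.3] -/
theorem exists_indexed_laminar_refinement {D : Set (Fin m → ℝ)} (hDc : IsCompact D) (hDs : IsSemialgebraic ℝ D)
    {a b : (Fin m → ℝ) → ℝ} (ha : Continuous a) (hb : Continuous b)
    (has : IsSemialgebraicFunOn ℝ univ a) (hbs : IsSemialgebraicFunOn ℝ univ b) (hab : ∀ x ∈ D, a x ≤ b x)
    (hq : 0 < q) {V : Fin q → Set (Fin (m + 1) → ℝ)} (hVo : ∀ j, IsOpen (V j)) (hVs : ∀ j, IsSemialgebraic ℝ (V j))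
    (hcov : ∀ x ∈ D, ∀ t ∈ Ioo (a x) (b x), ∃ j, (Fin.snoc x t : Fin (m + 1) → ℝ) ∈ V j) :
    ∃ (r : ℕ) (β : ℕ → (Fin m → ℝ) → ℝ) (jw : ℕ → Fin q),
      (∀ n, ContinuousOn (β n) D) ∧ (∀ n, IsSemialgebraicFunOn ℝ D (β n)) ∧
      (∀ x ∈ D, Monotone fun n => β n x) ∧ (∀ x ∈ D, β 0 x = a x) ∧ (∀ x ∈ D, ∀ n, r ≤ n → β n x = b x) ∧
      ∀ n, ∀ x ∈ D, β n x < β (n + 1) x →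
        ∀ t ∈ Ioo (β n x) (β (n + 1) x), (Fin.snoc x t : Fin (m + 1) → ℝ) ∈ V (jw n) := by
  -- Part I: lens families
  obtain ⟨F, rfl, rfl, rfl, rfl, HF, SF⟩ := exists_lensFamilies hDc hDs ha hb has hbs hab hVo hVs hcov
  -- global continuous semialgebraic extensions of the laminar functions `α k`
  have hext : ∀ k, ∃ G : (Fin m → ℝ) → ℝ, Continuous G ∧ IsSemialgebraicFunOn ℝ univ G ∧ EqOn G (F.α k) F.D :=
    fun k => exists_continuous_semialgebraic_extension hDc hDs (LensFamilies.α_sa SF k) (LensFamilies.continuousOn_α HF k)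
  choose G hGc hGs hGeq using hext
  -- certified cuts on every free window
  have hwin : ∀ k, ∃ (𝒞 : Finset ((Fin m → ℝ) → ℝ)) (𝒦 : Set (Cert m q)),
      (∀ c ∈ 𝒞, Continuous c ∧ IsSemialgebraicFunOn ℝ univ c) ∧ 𝒦.Finite ∧
      (∀ κ ∈ 𝒦, κ.Good F.V ∧ IsSemialgebraic ℝ κ.O ∧ (κ.lo = G k ∨ κ.lo = G (k + 1) ∨ κ.lo ∈ 𝒞) ∧
        (κ.hi = G k ∨ κ.hi = G (k + 1) ∨ κ.hi ∈ 𝒞)) ∧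
      ∀ x ∈ F.Free k, CValid (F.α k) (F.α (k + 1)) 𝒞 𝒦 x := by
    intro k
    set Wk : FreeWindow m q := ⟨F.V, G k, G (k + 1), F.Free k⟩ with hWk
    have HW : Wk.Hyp :=
      { isOpen_V := hVo
        V_sa := hVs
        γ_cont := hGc k
        δ_cont := hGc (k + 1)
        γ_sa := hGs k
        δ_sa := hGs (k + 1)
        Fr_sa := LensFamilies.free_sa SF k
        Fr_bdd := hDc.isBounded.subset (LensFamilies.free_subset k)
        γ_lt_δ := fun x hx => by
          show G k x < G (k + 1) x
          rw [hGeq k hx.1, hGeq (k + 1) hx.1]; exact hx.2.1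
        pinch := fun z hz hnz => by
          have hzD : z ∈ F.D := closure_minimal (LensFamilies.free_subset k) hDc.isClosed hz
          show G k z = G (k + 1) z
          rw [hGeq k hzD, hGeq (k + 1) hzD]
          exact LensFamilies.α_eq_of_mem_closure_free HF hz hnz
        cover := fun x hx t ht => by
          have hxD : x ∈ F.D := hx.1
          have ht' : t ∈ Icc (F.α k x) (F.α (k + 1) x) := by
            have h1 : G k x = F.α k x := hGeq k hxD
            have h2 : G (k + 1) x = F.α (k + 1) x := hGeq (k + 1) hxD
            exact ⟨h1 ▸ ht.1, h2 ▸ ht.2⟩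
          exact LensFamilies.exists_mem_V_of_free HF hx ht' }
    obtain ⟨𝒞, 𝒦, h𝒞, hfin, hOK, hval⟩ := FreeWindow.exists_cvalid_free HW
    refine ⟨𝒞, 𝒦, h𝒞, hfin, hOK, fun x hx => ?_⟩
    exact (cvalid_congr (hGeq k hx.1) (hGeq (k + 1) hx.1)).1 (hval x hx)
  choose 𝒞k 𝒦k h𝒞k hfink hOKk hvalk using hwin
  -- the full cut family and certificate set
  set 𝒞 : Finset ((Fin m → ℝ) → ℝ) :=
    Finset.univ.image F.cuts ∪ (Finset.range (F.N + 1)).biUnion 𝒞k ∪ (Finset.range (F.N + 2)).image G with h𝒞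
  set 𝒦 : Set (Cert m q) := F.lensCerts ∪ ⋃ k ∈ Finset.range (F.N + 1), 𝒦k k with h𝒦
  have hcuts : ∀ j, F.cuts j ∈ 𝒞 := fun j =>
    Finset.mem_union_left _ (Finset.mem_union_left _ (Finset.mem_image.2 ⟨j, Finset.mem_univ _, rfl⟩))
  have h𝒞k_sub : ∀ k ≤ F.N, 𝒞k k ⊆ 𝒞 := fun k hk =>
    (Finset.subset_biUnion_of_mem 𝒞k (Finset.mem_range.2 (Nat.lt_succ_of_le hk))).trans
      (Finset.subset_union_right.trans Finset.subset_union_left)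
  have hG_mem : ∀ k ≤ F.N + 1, G k ∈ 𝒞 := fun k hk =>
    Finset.mem_union_right _ (Finset.mem_image.2 ⟨k, Finset.mem_range.2 (Nat.lt_succ_of_le hk), rfl⟩)
  have h𝒦k_sub : ∀ k ≤ F.N, 𝒦k k ⊆ 𝒦 := fun k hk =>
    subset_union_right.trans' (subset_iUnion₂ (s := fun k _ => 𝒦k k) k (Finset.mem_range.2 (Nat.lt_succ_of_le hk)))
  -- members of `𝒞` are continuous and semialgebraic
  have hmem𝒞 : ∀ c ∈ 𝒞, Continuous c ∧ IsSemialgebraicFunOn ℝ univ c := by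
    intro c hc
    rcases Finset.mem_union.1 hc with hc | hc
    · rcases Finset.mem_union.1 hc with hc | hc
      · obtain ⟨j, -, rfl⟩ := Finset.mem_image.1 hc
        exact ⟨LensFamilies.continuous_cuts HF j, LensFamilies.cuts_sa SF j⟩
      · obtain ⟨k, -, hck⟩ := Finset.mem_biUnion.1 hc
        exact h𝒞k k c hck
    · obtain ⟨k, -, rfl⟩ := Finset.mem_image.1 hc
      exact ⟨hGc k, hGs k⟩
  -- certified validity on `D`
  have hvalid : ∀ x ∈ F.D, CValid F.a F.b 𝒞 𝒦 x := fun x hx =>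
    LensFamilies.cvalid_of_free HF 𝒞 hcuts subset_union_left
      (fun k hk x hxk => (hvalk k x hxk).mono (h𝒞k_sub k hk) (h𝒦k_sub k hk)) hx
  -- enumerate the cut family
  set e := 𝒞.equivFin with he
  set c : Fin 𝒞.card → (Fin m → ℝ) → ℝ := fun i => (e.symm i).1 with hc
  have himg : Finset.univ.image c = 𝒞 := by
    ext f
    constructor
    · intro hf
      obtain ⟨i, -, rfl⟩ := Finset.mem_image.1 hf
      exact (e.symm i).2
    · intro hf
      exact Finset.mem_image.2 ⟨e ⟨f, hf⟩, Finset.mem_univ _, by simp [hc]⟩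
  have hsurj : ∀ f ∈ 𝒞, ∃ i, f = c i := fun f hf => ⟨e ⟨f, hf⟩, by simp [hc]⟩
  -- the certified family
  set CF : CertFamily m q := ⟨F.D, F.a, F.b, 𝒞.card, c, F.V, 𝒦⟩ with hCF
  have hmem3 : ∀ f, f ∈ 𝒞 → f = F.a ∨ f = F.b ∨ ∃ i, f = c i := fun f hf => Or.inr (Or.inr (hsurj f hf))
  have HCF : CF.Hyp :=
    { D_closed := hDc.isClosed
      a_cont := ha.continuousOn
      b_cont := hb.continuousOn
      c_cont := fun i => (hmem𝒞 _ (e.symm i).2).1.continuousOn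
      a_le_b := hab
      good := by
        rintro κ (hκ | hκ)
        · exact LensFamilies.lensCerts_good HF hκ
        · obtain ⟨k, hk, hκk⟩ := mem_iUnion₂.1 hκ
          exact (hOKk k κ hκk).1
      lo_mem := by
        rintro κ (hκ | hκ)
        · rcases hκ with ⟨i, rfl⟩ | ⟨i, rfl⟩
          · refine hmem3 _ ?_
            show F.bm i ∈ 𝒞
            rw [← LensFamilies.cuts_bm F i]; exact hcuts _
          · refine hmem3 _ ?_
            show F.tm i ∈ 𝒞
            rw [← LensFamilies.cuts_tm F i]; exact hcuts _
        · obtain ⟨k, hk, hκk⟩ := mem_iUnion₂.1 hκ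
          have hk' : k ≤ F.N := Nat.le_of_lt_succ (Finset.mem_range.1 hk)
          rcases (hOKk k κ hκk).2.2.1 with h | h | h
          · exact hmem3 _ (h ▸ hG_mem k (by omega))
          · exact hmem3 _ (h ▸ hG_mem (k + 1) (by omega))
          · exact hmem3 _ (h𝒞k_sub k hk' h)
      hi_mem := by
        rintro κ (hκ | hκ)
        · rcases hκ with ⟨i, rfl⟩ | ⟨i, rfl⟩
          · refine hmem3 _ ?_
            show F.bp i ∈ 𝒞
            rw [← LensFamilies.cuts_bp F i]; exact hcuts _
          · refine hmem3 _ ?_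
            show F.tp i ∈ 𝒞
            rw [← LensFamilies.cuts_tp F i]; exact hcuts _
        · obtain ⟨k, hk, hκk⟩ := mem_iUnion₂.1 hκ
          have hk' : k ≤ F.N := Nat.le_of_lt_succ (Finset.mem_range.1 hk)
          rcases (hOKk k κ hκk).2.2.2 with h | h | h
          · exact hmem3 _ (h ▸ hG_mem k (by omega))
          · exact hmem3 _ (h ▸ hG_mem (k + 1) (by omega))
          · exact hmem3 _ (h𝒞k_sub k hk' h)
      valid := fun x hx => by
        show CValid F.a F.b (Finset.univ.image c) 𝒦 x
        rw [himg]; exact hvalid x hx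
      q_pos := hq }
  have SCF : CF.SA :=
    { D_sa := hDs
      a_sa := has.mono (subset_univ _) hDs
      b_sa := hbs.mono (subset_univ _) hDs
      c_sa := fun i => (hmem𝒞 _ (e.symm i).2).2.mono (subset_univ _) hDs
      O_sa := by
        rintro κ (hκ | hκ)
        · rcases hκ with ⟨i, rfl⟩ | ⟨i, rfl⟩ <;> exact isSemialgebraic_univ
        · obtain ⟨k, hk, hκk⟩ := mem_iUnion₂.1 hκ
          exact (hOKk k κ hκk).2.1
      𝒦_fin := LensFamilies.lensCerts_finite.union
        (Set.Finite.biUnion (Finset.range (F.N + 1)).finite_toSet fun k _ => hfink k) }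
  obtain ⟨r, β, jw, h1, h2, h3, h4, h5, -, h7⟩ := CertFamily.exists_indexed_laminar HCF SCF
  exact ⟨r, β, jw, h1, h2, h3, h4, h5, h7⟩

end StrongRCL

end Literature.ModelTheory.ExponentialFields
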